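import Mathlib
import Summits.ResolutionOfSingularities.ResolutionOfSingularities.Theorems.WeightedInvariantLocalWeightedDropNCResSettingNear
import Summits.ResolutionOfSingularities.ResolutionOfSingularities.Theorems.WeightedInvariantLocalWeightedDropNCResSettingAdmissible
import Summits.ResolutionOfSingularities.ResolutionOfSingularities.Theorems.WeightedInvariantLocalWeightedDropNCResSettingCurve
import Summits.ResolutionOfSingularities.ResolutionOfSingularities.Theorems.WeightedInvariantLocalWeightedDropNCGameDecoratedWins
import Summits.ResolutionOfSingularities.ResolutionOfSingularities.Theorems.WeightedInvariantLocalWeightedDropTOT2Near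
import Summits.ResolutionOfSingularities.ResolutionOfSingularities.Theorems.WeightedInvariantLocalWeightedDropTOT2NearCurve

/-!
# `WeightedInvariant.LocalWeightedDrop`: NC-RESOLUTION SETTINGS for the TOT₂ line (S-SET), part 12 — THE HEAD-DROP ADAPTER:
# the I₃-device `g = f · ∏_{l ∈ O} x_l` through a B-permissible move, «g-level order drop at an answer ⇒ the head `(o, c)` drops», and the
# one-move regime exits (E0: trivial apex; the permissible coordinate axis at apex dimension ≤ 1) in decorated `DWinsTo` form

Crux item stmt-ResolutionOfSingularities-8899 `LocalWeightedDrop` (route `ResolutionOfSingularities/WeightedInvariant`), ENGINE skeleton v32,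
residual `stub_spaceNCRankDrop`; TOT2-LINE v1.1 (B) «the I₃-device: in a decorated state put g := f · ∏_{h ∈ O} h (order c = o + |O|); the TARGET of a
phase is "ord g drops below c" ⇔ (o, |O|) drops lex» and (E) S-E0 / S-NEAR (res-L1-w43-lead-1 g4, `L/res-L1-w43-lead-1/g4/TOT2-LINE.md`).
[OURS · L1 W4.3 · chain w43 · seat res-L1-w43-stub-1 gen 6 (S-SET author); def-free bookkeeping on the S-SET definitions (`Decoration.fChart/strict/
newLetters/transform`, p528587) consuming res-L1-w43-stub-3's S-NEAR theorems (N1) `TOT2Near.order_slice_lt_of_apexTrivial` (p529015) and (N3)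
`TOT2Near.order_slice_lt_of_apexLine_curve` (p531441) WITHOUT restating them; the count game is the programme's own (res-type-056); nothing here is a
statement of any manuscript; AI-produced, gate-checked, weaker than expert review.]

* `Decoration.weight_strIdx_eq_one_of_mem_O` — under a B-permissible move every OLD letter is straightened to a weight-`1` slot ((P2)).
* **`Decoration.prod_chart_eq`**, **`Decoration.totalO_chart_eq`** — THE I₃-DEVICE THROUGH A B-PERMISSIBLE MOVE: at an exceptional point `c` and a live
  slot `i`, `(f · ∏_{l∈O} x_l)∘Φ∘chart = s^{c} · H` with `s ∤ H` (exponent EXACTLY `c = o + |O|` by (P1) + (P2)), and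
  `H|_{y_i = 0} = unit · (sliced strict transform of f) · ∏_{old letters through the new point} (new letter)`.
* **`Decoration.order_slice_totalO_eq`** — hence the g-level successor order is `ord (strict) + #{old letters through the new point}`.
* **`Decoration.head_transform_lt_of_order_slice_lt`** — g-LEVEL ORDER DROP AT AN ANSWER ⇒ HEAD DROP: if the sliced `H` has order `< c` then
  `(δ.transform Φ w c i).head < δ.head` (either `o′ < o`, or `o′ = o` and strictly fewer old letters pass through the new point).
* **`moveClause_headDrop_of_orderDrop`**, **`dWinsTo_headDrop_of_orderDrop`** — DECORATED PACKAGING: one B-permissible move all of whose g-answers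
  are non-near (sliced order `< c` at every live slot) satisfies the move clause for «admissibly decorated of smaller head», hence wins the
  head phase of `…NCResPhaseAssembly` in one move.
* **`dWinsTo_headDrop_of_apexTrivial`** — REGIME E0 (apex of `in_c g` trivial): the identity point move wins the head phase ((N1) on `g`).
* `isBPermissible_X_indicator_of_totalO`, **`dWinsTo_headDrop_of_apexLine_axis`** — the PERMISSIBLE COORDINATE AXIS at apex dimension `≤ 1`
  (`c ≤` the `𝟙_S`-weighted order of `g`, every two invariance vectors of `in_c g` dependent, some slot outside `S`): the curve move `(X, 𝟙_S)` is
  B-permissible (letters are coordinate hyperplanes, hence NC with the coordinate centre) and wins the head phase in one move ((N3) on `g`) — the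
  sub-regime «`e(g) = 1`, point ON a permissible curve that is a coordinate axis in the current letters», excluded by res-type-056's S-E1
  hypothesis HISOL and not entered by the `e = 2` label regime.
-/

set_option linter.dupNamespace false -- mandated namespace of this single-conjunct summit

noncomputable section

namespace Summit.ResolutionOfSingularities.ResolutionOfSingularities.Theorems

namespace TameFourTupleDrop

open MvPowerSeries Literature.AlgebraicGeometry.Resolution

variable {k : Type} [Field k] {m : ℕ}

/-! ## Local tools -/

/-- Uniqueness of the `s`-saturation: `sᵃ·G = sᵇ·H`, `s ∤ G`, `s ∤ H` ⇒ `a = b ∧ G = H` (local copy of the GradedGame lemma, to keep imports light). -/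
theorem eq_of_X_zero_pow_mul_eq {G H : MvPowerSeries (Fin (m + 1 + 1)) k} {a b : ℕ}
    (h : X 0 ^ a * G = X 0 ^ b * H) (hG : ¬ X 0 ∣ G) (hH : ¬ X 0 ∣ H) : a = b ∧ G = H := by
  have hX : (X (0 : Fin (m + 1 + 1)) : MvPowerSeries (Fin (m + 1 + 1)) k) ≠ 0 := (MvPowerSeries.prime_X' k _).ne_zero
  have key : ∀ {G H : MvPowerSeries (Fin (m + 1 + 1)) k} {a b : ℕ}, a ≤ b →
      X 0 ^ a * G = X 0 ^ b * H → ¬ X 0 ∣ G → a = b ∧ G = H := by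
    intro G H a b hab h hG
    obtain ⟨d, rfl⟩ := Nat.exists_eq_add_of_le hab
    rw [pow_add, mul_assoc] at h
    have h' : G = X 0 ^ d * H := mul_left_cancel₀ (pow_ne_zero a hX) h
    cases d with
    | zero => exact ⟨by simp, by simpa using h'⟩
    | succ d => exact absurd ⟨X 0 ^ d * H, by rw [h', pow_succ]; ring⟩ hG
  rcases le_total a b with hab | hba
  · exact key hab h hG
  · obtain ⟨h1, h2⟩ := key hba h.symm hH
    exact ⟨h1.symm, h2.symm⟩

/-- The slice is multiplicative over finite products (local copy; the tree's `slice_finset_prod` is res-L1-w43-stub-2's, p530471). -/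
private theorem slice_finset_prod'' {ι : Type} (i : Fin (m + 1)) (s : Finset ι) (f : ι → MvPowerSeries (Fin (m + 1 + 1)) k) :
    TupleGame.slice i (∏ x ∈ s, f x) = ∏ x ∈ s, TupleGame.slice i (f x) := by
  unfold TupleGame.slice
  rw [← coe_substAlgHom (CobordantChartPlaneSlice.hasSubst_slice (R := k) i), map_prod]

/-- `s` does not divide `c + y_j` (local copy; the tree's `not_X_zero_dvd_C_add_X_succ` is res-L1-w43-stub-2's, p530471). -/
private theorem not_X_zero_dvd_C_add_X_succ'' (r : k) (j : Fin (m + 1)) :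
    ¬ (X 0 : MvPowerSeries (Fin (m + 1 + 1)) k) ∣ (C r + X j.succ) := by
  intro h
  have h1 := X_dvd_iff.mp h (Finsupp.single j.succ 1) (by rw [Finsupp.single_apply, if_neg (Fin.succ_ne_zero j)])
  rw [map_add, coeff_C, if_neg (Finsupp.single_ne_zero.mpr one_ne_zero), coeff_X, if_pos rfl, zero_add] at h1
  exact one_ne_zero h1

/-- A germ with non-zero constant coefficient has order `0` (local copy; the public one is res-L1-w43-stub-2's, …TOT2BridgeCurvePermissible). -/
private theorem order_eq_zero_of_constantCoeff_ne_zero' {n : ℕ} {U : MvPowerSeries (Fin n) k} (hU : constantCoeff U ≠ 0) : U.order = 0 := by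
  have h := order_le (f := U) (d := 0) (by rwa [coeff_zero_eq_constantCoeff])
  rw [map_zero, Nat.cast_zero] at h
  exact nonpos_iff_eq_zero.mp h

/-! ## Old letters are straightened to weight-one slots -/

/-- **(P2) READ ON THE SLOTS.**  Under a B-permissible move every old letter `l ∈ O` is straightened (`Φ l = u · X l'`) to a slot `l' = strIdx Φ l`
of weight EXACTLY `1` (the centre lies inside every old component). -/
theorem Decoration.weight_strIdx_eq_one_of_mem_O {δ : Decoration k m} {Φ : Fin (m + 1) → MvPowerSeries (Fin (m + 1)) k}
    {w : Fin (m + 1) → ℕ} (hperm : IsBPermissible δ Φ w) {l : Fin (m + 1)} (hl : l ∈ δ.O) : w (strIdx Φ l) = 1 := by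
  obtain ⟨hmv, -, hP2, hP3⟩ := hperm
  obtain ⟨u, hu, hul⟩ := strIdx_spec (hP3 l (δ.O_subset hl))
  have h1 := hP2 l hl
  refine le_antisymm (hmv.2.2.1 _) ?_
  -- `weightedOrder (u · X l') = weightedOrder u + weightedOrder (X l') ≤ 0 + w l'`
  have hu0 : u.weightedOrder w ≤ 0 := by
    have h := weightedOrder_le (w := w) (f := u) (d := 0) (by rwa [coeff_zero_eq_constantCoeff])
    rwa [map_zero] at h
  have hX : (X (strIdx Φ l) : MvPowerSeries (Fin (m + 1)) k).weightedOrder w = w (strIdx Φ l) := by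
    rw [X_def, weightedOrder_monomial_of_ne_zero (w := w) (one_ne_zero' k), Finsupp.weight_single, one_smul]
  rw [hul, weightedOrder_mul, hX] at h1
  have h2 : (1 : ℕ∞) ≤ 0 + (w (strIdx Φ l) : ℕ∞) := h1.trans (add_le_add hu0 le_rfl)
  rw [zero_add] at h2
  exact_mod_cast h2

/-! ## The I₃-device through a B-permissible move -/

open Classical in
/-- **A PARTIAL BOUNDARY PRODUCT THROUGH A B-PERMISSIBLE MOVE.**  For `S ⊆ E`, at an exceptional point `c` (chart convention) and a live slot `i`:
`(f · ∏_{l∈S} x_l)∘Φ∘chart = s^{A_f + Σ_{l∈S} w_{l'}} · H`, `s ∤ H`, and `H|_{y_i=0} = U · (f's sliced strict transform) · ∏_{l ∈ S, c_{l'} = 0} y'_{new l}`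
with `U` a unit (the components of `S` not through the new point become units). -/
theorem Decoration.prod_chart_eq {δ : Decoration k m} {Φ : Fin (m + 1) → MvPowerSeries (Fin (m + 1)) k} {w : Fin (m + 1) → ℕ}
    {c : Fin (m + 1) → k} (hperm : IsBPermissible δ Φ w) (hc : ∀ l, w l = 0 → c l = 0) (hf : δ.f ≠ 0) {i : Fin (m + 1)} (hci : c i ≠ 0)
    {S : Finset (Fin (m + 1))} (hS : S ⊆ δ.E) :
    ∃ (H : MvPowerSeries (Fin (m + 1 + 1)) k) (U : MvPowerSeries (Fin (m + 1)) k),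
      subst (CobordantChart.chart w c) (subst Φ (δ.f * ∏ l ∈ S, X l)) =
          X 0 ^ (satExp (δ.fChart Φ w c) + ∑ l ∈ S, w (strIdx Φ l)) * H ∧ ¬ X 0 ∣ H ∧ constantCoeff U ≠ 0 ∧
      TupleGame.slice i H = U * (δ.strict Φ w c i *
        ∏ l ∈ S.filter (fun l => c (strIdx Φ l) = 0), X (Fin.predAbove i (Fin.succ (strIdx Φ l)))) := by
  obtain ⟨hmv, -, -, hP3⟩ := hperm
  have hΦs : HasSubst Φ := hasSubst_of_constantCoeff_zero hmv.1
  have hch := CobordantChart.hasSubst_chart w c hc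
  have hsl := CobordantChartPlaneSlice.hasSubst_slice (R := k) i
  have hprime := MvPowerSeries.prime_X' k (0 : Fin (m + 1 + 1))
  -- the units straightening the boundary letters
  have key : ∀ l, ∃ u : MvPowerSeries (Fin (m + 1)) k, l ∈ S → constantCoeff u ≠ 0 ∧ Φ l = u * X (strIdx Φ l) := by
    intro l
    by_cases hl : l ∈ S
    · obtain ⟨u, hu, hul⟩ := strIdx_spec (hP3 l (hS hl))
      exact ⟨u, fun _ => ⟨hu, hul⟩⟩
    · exact ⟨1, fun h => absurd h hl⟩
  choose uf huf using key
  -- the factors `R_l = (u_l∘chart) · (c_{l'} + y_{l'})` and their exponents `w_{l'}`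
  set R : Fin (m + 1) → MvPowerSeries (Fin (m + 1 + 1)) k :=
    fun l => subst (CobordantChart.chart w c) (uf l) * (C (c (strIdx Φ l)) + X (strIdx Φ l).succ) with hR
  obtain ⟨hfacf, hGf⟩ := Decoration.fChart_eq (δ := δ) (c := c) hmv hc hf
  refine ⟨satPart (δ.fChart Φ w c) * ∏ l ∈ S, R l,
    (∏ l ∈ S, TupleGame.slice i (subst (CobordantChart.chart w c) (uf l))) *
      ∏ l ∈ S.filter (fun l => ¬ c (strIdx Φ l) = 0), (C (c (strIdx Φ l)) +
        if strIdx Φ l = i then 0 else X (Fin.predAbove i (Fin.succ (strIdx Φ l)))), ?_, ?_, ?_, ?_⟩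
  · -- the factorisation
    have hl : ∀ l ∈ S, subst (CobordantChart.chart w c) (subst Φ (X l : MvPowerSeries (Fin (m + 1)) k)) =
        X 0 ^ w (strIdx Φ l) * R l := by
      intro l hl
      rw [subst_X hΦs, (huf l hl).2, ← coe_substAlgHom hch, map_mul, coe_substAlgHom, subst_X hch, CobordantChart.chart_apply, hR]
      ring
    rw [← coe_substAlgHom hΦs, map_mul, map_prod, ← coe_substAlgHom hch, map_mul, map_prod, coe_substAlgHom,
      coe_substAlgHom, hfacf, Finset.prod_congr rfl hl, Finset.prod_mul_distrib, Finset.prod_pow_eq_pow_sum, pow_add]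
    ring
  · -- `s ∤ H`
    intro h
    rcases hprime.dvd_or_dvd h with h1 | h2
    · exact hGf h1
    · obtain ⟨l, hl, hRl⟩ := (Prime.dvd_finsetProd_iff hprime _).mp h2
      rw [hR] at hRl
      rcases hprime.dvd_or_dvd hRl with h3 | h4
      · exact not_X_dvd_of_constantCoeff_ne_zero (by rw [constantCoeff_subst_chart_subst' hc]; exact (huf l hl).1) h3
      · exact not_X_zero_dvd_C_add_X_succ'' _ _ h4
  · -- the unit
    rw [map_mul, map_prod, map_prod]
    refine mul_ne_zero (Finset.prod_ne_zero_iff.mpr fun l hl => ?_) (Finset.prod_ne_zero_iff.mpr fun l hl => ?_)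
    · rw [constantCoeff_slice, constantCoeff_subst_chart_subst' hc]; exact (huf l hl).1
    · have hne := (Finset.mem_filter.mp hl).2
      split_ifs <;> simpa [constantCoeff_X] using hne
  · -- the sliced form
    have hsR : ∀ l, TupleGame.slice i (R l) = TupleGame.slice i (subst (CobordantChart.chart w c) (uf l)) *
        (C (c (strIdx Φ l)) + if strIdx Φ l = i then 0 else X (Fin.predAbove i (Fin.succ (strIdx Φ l)))) := by
      intro l
      rw [hR]
      unfold TupleGame.slice
      rw [← coe_substAlgHom hsl, map_mul, map_add, coe_substAlgHom, subst_C, subst_X hsl]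
      congr 2
      by_cases h : strIdx Φ l = i
      · rw [if_pos (by rw [h]), if_pos h]
      · rw [if_neg (fun h' => h (Fin.succ_injective _ h')), if_neg h]
    have hzero : ∀ l ∈ S.filter (fun l => c (strIdx Φ l) = 0), (C (c (strIdx Φ l)) +
        if strIdx Φ l = i then (0 : MvPowerSeries (Fin (m + 1)) k) else X (Fin.predAbove i (Fin.succ (strIdx Φ l)))) =
        X (Fin.predAbove i (Fin.succ (strIdx Φ l))) := by
      intro l hl
      have h0 := (Finset.mem_filter.mp hl).2
      have hne : strIdx Φ l ≠ i := fun h => hci (h ▸ h0)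
      rw [h0, map_zero, zero_add, if_neg hne]
    unfold Decoration.strict
    rw [slice_mul, slice_finset_prod'', Finset.prod_congr rfl (fun l _ => hsR l), Finset.prod_mul_distrib,
      ← Finset.prod_filter_mul_prod_filter_not S (fun l => c (strIdx Φ l) = 0)
        (fun l => C (c (strIdx Φ l)) + if strIdx Φ l = i then (0 : MvPowerSeries (Fin (m + 1)) k)
          else X (Fin.predAbove i (Fin.succ (strIdx Φ l)))),
      Finset.prod_congr rfl hzero]
    ring

/-- Under a B-permissible move the total-transform exponent of the equation is `o` (natural-number form of `satExp_fChart_eq_order`). -/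
theorem Decoration.satExp_fChart_eq_o {δ : Decoration k m} {Φ : Fin (m + 1) → MvPowerSeries (Fin (m + 1)) k} {w : Fin (m + 1) → ℕ}
    {c : Fin (m + 1) → k} (hperm : IsBPermissible δ Φ w) (hc : ∀ l, w l = 0 → c l = 0) (hf : δ.f ≠ 0) :
    satExp (δ.fChart Φ w c) = δ.o := by
  have h := Decoration.satExp_fChart_eq_order (c := c) hperm hc hf
  rw [Decoration.o, ← h, ENat.toNat_coe]

open Classical in
/-- **THE I₃-DEVICE THROUGH A B-PERMISSIBLE MOVE.**  At an exceptional point `c` (chart convention) and a live slot `i`: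
`(f · ∏_{l∈O} x_l)∘Φ∘chart = s^{c} · H` with `s ∤ H` — the exponent is EXACTLY the head letter `c = o + |O|` ((P1): `A_f = o`; (P2): old letters sit
on weight-`1` slots) — and `H|_{y_i=0} = U · (sliced strict transform of f) · ∏_{old letters through the new point} (their new letters)`, `U` a unit. -/
theorem Decoration.totalO_chart_eq {δ : Decoration k m} {Φ : Fin (m + 1) → MvPowerSeries (Fin (m + 1)) k} {w : Fin (m + 1) → ℕ}
    {c : Fin (m + 1) → k} (hperm : IsBPermissible δ Φ w) (hc : ∀ l, w l = 0 → c l = 0) (hf : δ.f ≠ 0) {i : Fin (m + 1)} (hci : c i ≠ 0) :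
    ∃ (H : MvPowerSeries (Fin (m + 1 + 1)) k) (U : MvPowerSeries (Fin (m + 1)) k),
      subst (CobordantChart.chart w c) (subst Φ (δ.f * ∏ l ∈ δ.O, X l)) = X 0 ^ δ.c * H ∧ ¬ X 0 ∣ H ∧ constantCoeff U ≠ 0 ∧
      TupleGame.slice i H = U * (δ.strict Φ w c i *
        ∏ l ∈ δ.O.filter (fun l => c (strIdx Φ l) = 0), X (Fin.predAbove i (Fin.succ (strIdx Φ l)))) := by
  obtain ⟨H, U, hfac, hH, hU, hsl⟩ := Decoration.prod_chart_eq hperm hc hf hci δ.O_subset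
  refine ⟨H, U, ?_, hH, hU, hsl⟩
  have hexp : satExp (δ.fChart Φ w c) + ∑ l ∈ δ.O, w (strIdx Φ l) = δ.c := by
    rw [Decoration.satExp_fChart_eq_o hperm hc hf, Finset.sum_congr rfl fun l hl => Decoration.weight_strIdx_eq_one_of_mem_O hperm hl,
      Finset.sum_const, smul_eq_mul, mul_one, Decoration.c]
  rw [hfac, hexp]

open Classical in
/-- **THE g-LEVEL SUCCESSOR ORDER.**  In the situation of `totalO_chart_eq`, for ANY `s`-saturation `s^A · G` of `(f·∏_O x_l)∘Φ∘chart` with `s ∤ G`: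
`A = c` and `ord (G|_{y_i=0}) = ord (sliced strict transform of f) + #{old letters through the new point}`. -/
theorem Decoration.order_slice_totalO_eq {δ : Decoration k m} {Φ : Fin (m + 1) → MvPowerSeries (Fin (m + 1)) k} {w : Fin (m + 1) → ℕ}
    {c : Fin (m + 1) → k} (hperm : IsBPermissible δ Φ w) (hc : ∀ l, w l = 0 → c l = 0) (hf : δ.f ≠ 0) {i : Fin (m + 1)} (hci : c i ≠ 0)
    {A : ℕ} {G : MvPowerSeries (Fin (m + 1 + 1)) k}
    (hfac : subst (CobordantChart.chart w c) (subst Φ (δ.f * ∏ l ∈ δ.O, X l)) = X 0 ^ A * G) (hG : ¬ X 0 ∣ G) :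
    A = δ.c ∧ (TupleGame.slice i G).order = (δ.strict Φ w c i).order + (Decoration.newLetters δ.O Φ c i).card := by
  obtain ⟨H, U, hfacH, hH, hU, hsl⟩ := Decoration.totalO_chart_eq hperm hc hf hci
  obtain ⟨hA, hGH⟩ := eq_of_X_zero_pow_mul_eq (hfac.symm.trans hfacH) hG hH
  refine ⟨hA, ?_⟩
  rw [hGH, hsl, ← Decoration.prod_X_newLetters hperm c hci δ.O_subset, order_mul, order_eq_zero_of_constantCoeff_ne_zero' hU, zero_add,
    order_mul_prod_X]

/-! ## g-level order drop at an answer ⇒ head drop -/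

open Classical in
/-- **g-LEVEL ORDER DROP AT AN ANSWER ⇒ THE HEAD DROPS** (OURS · L1 W4.3, S-SET; the I₃-device of TOT2-LINE v1.1 (B) in the count game).
From an admissibly decorated position and a B-permissible move, at an exceptional point `c` and a live slot `i`: if the `s`-saturated chart
transform `s^A · G` of `g = f · ∏_{l∈O} x_l` has `ord (G|_{y_i=0}) < c = o + |O|`, then `(δ.transform Φ w c i).head < δ.head` — either the order
letter drops (`o' < o`), or `o' = o` and strictly fewer old letters pass through the new point (`c' < c`). -/
theorem Decoration.head_transform_lt_of_order_slice_lt {b : MvPowerSeries (Fin (m + 1)) k} {δ : Decoration k m}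
    {Φ : Fin (m + 1) → MvPowerSeries (Fin (m + 1)) k} {w : Fin (m + 1) → ℕ} {c : Fin (m + 1) → k} {i : Fin (m + 1)}
    (hadm : Admissible b δ) (hperm : IsBPermissible δ Φ w) (hc : ∀ l, w l = 0 → c l = 0) (hci : c i ≠ 0)
    {A : ℕ} {G : MvPowerSeries (Fin (m + 1 + 1)) k}
    (hfac : subst (CobordantChart.chart w c) (subst Φ (δ.f * ∏ l ∈ δ.O, X l)) = X 0 ^ A * G) (hG : ¬ X 0 ∣ G)
    (hlt : (TupleGame.slice i G).order < (δ.c : ℕ∞)) : (δ.transform Φ w c i).head < δ.head := by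
  have hf : δ.f ≠ 0 := hadm.2.1.ne_zero
  obtain ⟨-, hord⟩ := Decoration.order_slice_totalO_eq hperm hc hf hci hfac hG
  by_cases ho : (δ.transform Φ w c i).o < δ.o
  · exact Decoration.head_transform_lt_of_o_lt ho
  · -- `o' = o`: the sliced strict transform keeps the order, so fewer old letters pass through the new point
    have hole : (δ.transform Φ w c i).o ≤ δ.o := Decoration.o_transform_le hperm hc hf hci
    have hoeq : (δ.transform Φ w c i).o = δ.o := le_antisymm hole (not_lt.mp ho)
    have hstrict : (δ.strict Φ w c i).order = δ.f.order := Decoration.order_strict_eq_of_o_transform_eq hperm hc hf hci hoeq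
    have hfo : δ.f.order = (δ.o : ℕ∞) := by
      rw [Decoration.o, ENat.coe_toNat]
      rw [ne_eq, order_eq_top_iff]; exact hf
    have ho' : ¬ ((sqfRep (δ.strict Φ w c i)).order).toNat < δ.o := by rwa [← Decoration.transform_o]
    have hO : (δ.transform Φ w c i).O = Decoration.newLetters δ.O Φ c i := Decoration.transform_O_of_not_lt _ _ _ _ _ ho'
    rw [hord, hstrict, hfo, ← Nat.cast_add, Nat.cast_lt] at hlt
    -- `hlt : δ.o + #(new old letters) < δ.c = δ.o + |O|`
    rw [Decoration.head, Decoration.head, Prod.Lex.toLex_lt_toLex]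
    refine Or.inr ⟨hoeq, ?_⟩
    show (δ.transform Φ w c i).c < δ.c
    simp only [Decoration.c] at hlt ⊢
    rw [hoeq, hO]
    exact hlt

/-! ## Decorated packaging: one move all of whose g-answers are non-near -/

/-- **THE MOVE CLAUSE OF A HEAD-DROPPING MOVE.**  From an admissibly decorated position, a B-permissible move ALL of whose g-answers are
non-near (at every exceptional point, every `s`-saturation of the transform of `g = f·∏_O x_l` and every live slot: sliced order `< c`)
satisfies the move clause for «admissibly decorated with strictly smaller head» (any live slot; the transform supplies the decoration). -/
theorem moveClause_headDrop_of_orderDrop {b : MvPowerSeries (Fin (m + 1)) k} {δ : Decoration k m}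
    {Φ : Fin (m + 1) → MvPowerSeries (Fin (m + 1)) k} {w : Fin (m + 1) → ℕ} (hadm : Admissible b δ) (hperm : IsBPermissible δ Φ w)
    (hdrop : ∀ c : Fin (m + 1) → k, (∀ l, w l = 0 → c l = 0) → c ≠ 0 →
      ∀ (A : ℕ) (G : MvPowerSeries (Fin (m + 1 + 1)) k),
        subst (CobordantChart.chart w c) (subst Φ (δ.f * ∏ l ∈ δ.O, X l)) = X 0 ^ A * G → ¬ X 0 ∣ G →
        ∀ i, c i ≠ 0 → (TupleGame.slice i G).order < (δ.c : ℕ∞)) :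
    MoveClause b Φ w (fun b' => ∃ δ' : Decoration k m, Admissible b' δ' ∧ δ'.head < δ.head) := by
  intro c hc hc0 A G hfac hG
  obtain ⟨i, hci⟩ : ∃ i, c i ≠ 0 := Function.ne_iff.mp hc0
  have hf : δ.f ≠ 0 := hadm.2.1.ne_zero
  obtain ⟨H, U, hfacH, hH, -, -⟩ := Decoration.totalO_chart_eq hperm hc hf hci
  exact ⟨i, hci, δ.transform Φ w c i, admissible_transform hadm hperm hc hfac hG hci,
    Decoration.head_transform_lt_of_order_slice_lt hadm hperm hc hci hfacH hH (hdrop c hc hc0 _ H hfacH hH i hci)⟩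

/-- **ONE HEAD-DROPPING MOVE WINS THE HEAD PHASE** (decorated `DWinsTo` form, product states read through `Prod.fst`, the currency of
`…NCResPhaseAssembly`): from an admissibly decorated position with a B-permissible move all of whose g-answers are non-near, the mover forces
«admissibly decorated of strictly smaller head» — in one move. -/
theorem dWinsTo_headDrop_of_orderDrop {b : MvPowerSeries (Fin (m + 1)) k} {δ : Decoration k m}
    {Φ : Fin (m + 1) → MvPowerSeries (Fin (m + 1)) k} {w : Fin (m + 1) → ℕ} (hadm : Admissible b δ) (hperm : IsBPermissible δ Φ w)
    (hdrop : ∀ c : Fin (m + 1) → k, (∀ l, w l = 0 → c l = 0) → c ≠ 0 →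
      ∀ (A : ℕ) (G : MvPowerSeries (Fin (m + 1 + 1)) k),
        subst (CobordantChart.chart w c) (subst Φ (δ.f * ∏ l ∈ δ.O, X l)) = X 0 ^ A * G → ¬ X 0 ∣ G →
        ∀ i, c i ≠ 0 → (TupleGame.slice i G).order < (δ.c : ℕ∞)) :
    DWinsTo (St := MvPowerSeries (Fin (m + 1)) k × Decoration k m) Prod.fst
      (fun τ => Admissible τ.1 τ.2 ∧ τ.2.head < δ.head) (b, δ) := by
  refine DWinsTo.of_measure (germ := (Prod.fst : MvPowerSeries (Fin (m + 1)) k × Decoration k m → MvPowerSeries (Fin (m + 1)) k))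
    ({(b, δ)} : Set (MvPowerSeries (Fin (m + 1)) k × Decoration k m)) (fun _ => 0) ?_ (Set.mem_singleton _)
  intro τ hτ _
  rw [Set.mem_singleton_iff] at hτ
  subst hτ
  exact ⟨Φ, w, hperm.1, (moveClause_headDrop_of_orderDrop hadm hperm hdrop).mono
    fun b' ⟨δ', hadm', hlt⟩ => ⟨(b', δ'), rfl, Or.inl ⟨hadm', hlt⟩⟩⟩

/-! ## Regime E0: trivial apex -/

/-- **REGIME E0 (apex of `in_c g` trivial) WINS THE HEAD PHASE IN ONE MOVE** (OURS · L1 W4.3; TOT2-LINE v1.1 (E) S-E0): the identity point move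
is B-permissible for every decoration (`isBPermissible_point_X`), and by res-L1-w43-stub-3's (N1) `TOT2Near.order_slice_lt_of_apexTrivial` applied
to `g = f · ∏_{l∈O} x_l` (order `c`), every answer is non-near. -/
theorem dWinsTo_headDrop_of_apexTrivial {b : MvPowerSeries (Fin (m + 1)) k} {δ : Decoration k m} (hadm : Admissible b δ)
    (hapex : ∀ u : Fin (m + 1) → k,
      (∀ v, CobordantChart.initEval (fun _ : Fin (m + 1) => 1) (v + u) δ.c (δ.f * ∏ l ∈ δ.O, X l) =
        CobordantChart.initEval (fun _ : Fin (m + 1) => 1) v δ.c (δ.f * ∏ l ∈ δ.O, X l)) → u = 0) :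
    DWinsTo (St := MvPowerSeries (Fin (m + 1)) k × Decoration k m) Prod.fst
      (fun τ => Admissible τ.1 τ.2 ∧ τ.2.head < δ.head) (b, δ) := by
  refine dWinsTo_headDrop_of_orderDrop hadm (isBPermissible_point_X δ) fun c hc hc0 A G hfac hG i hci => ?_
  have hf : δ.f ≠ 0 := hadm.2.1.ne_zero
  obtain ⟨hA, -⟩ := Decoration.order_slice_totalO_eq (isBPermissible_point_X δ) hc hf hci hfac hG
  subst hA
  rw [show subst (fun j => (X j : MvPowerSeries (Fin (m + 1)) k)) (δ.f * ∏ l ∈ δ.O, X l) = δ.f * ∏ l ∈ δ.O, X l from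
    congrFun subst_self _] at hfac
  exact TOT2Near.order_slice_lt_of_apexTrivial _ hapex c i hci hfac

/-! ## The permissible coordinate axis at apex dimension ≤ 1 -/

/-- **THE IDENTITY MOVE WITH A LETTER CENTRE IS B-PERMISSIBLE FROM THE I₃-DEVICE**: if `c ≤` the `𝟙_S`-weighted order of `g = f·∏_O x_l` (the
coordinate centre `V(x_j : j ∈ S)` is permissible for `g`), then the move `(X, 𝟙_S)` is B-permissible (equimultiplicity of `f`, `O ⊆ S`, and NC with
the letters — which are coordinate hyperplanes — all at once, by `isBPermissible_iff_totalO`). -/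
theorem isBPermissible_X_indicator_of_totalO {b : MvPowerSeries (Fin (m + 1)) k} {δ : Decoration k m} (hadm : Admissible b δ)
    {S : Finset (Fin (m + 1))} (hS : S.Nonempty)
    (hP1g : (δ.c : ℕ∞) ≤ (δ.f * ∏ l ∈ δ.O, X l).weightedOrder (fun j => if j ∈ S then 1 else 0)) :
    IsBPermissible δ (fun j => (X j : MvPowerSeries (Fin (m + 1)) k)) (fun j => if j ∈ S then 1 else 0) := by
  have hf : δ.f ≠ 0 := hadm.2.1.ne_zero
  have hmv : IsCountMove (fun j => (X j : MvPowerSeries (Fin (m + 1)) k)) (fun j => if j ∈ S then 1 else 0) :=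
    NCTransport.isCountMove_X_indicator hS
  refine (isBPermissible_iff_totalO hmv hf fun l _ => ⟨l, 1, by rw [map_one]; exact one_ne_zero, by rw [one_mul]⟩).mpr ?_
  rw [show subst (fun j => (X j : MvPowerSeries (Fin (m + 1)) k)) (δ.f * ∏ l ∈ δ.O, X l) = δ.f * ∏ l ∈ δ.O, X l from
    congrFun subst_self _, Decoration.order_totalO hadm]
  exact hP1g

/-- **THE PERMISSIBLE COORDINATE AXIS AT APEX DIMENSION ≤ 1 WINS THE HEAD PHASE IN ONE MOVE** (OURS · L1 W4.3): if the coordinate centre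
`V(x_j : j ∈ S)` is permissible for `g = f·∏_O x_l` (`c ≤ weightedOrder_{𝟙_S} g`), has a free slot `l₀ ∉ S` (a curve or bigger), and every two
invariance vectors of `in_c g` are dependent (`e(g) ≤ 1`), then the move `(X, 𝟙_S)` is B-permissible and every answer is non-near —
res-L1-w43-stub-3's (N3) `TOT2Near.order_slice_lt_of_apexLine_curve` applied to `g` (the directrix contains the centre's tangent directions, so with
`e ≤ 1` it IS the tangent line and no near point survives).  The sub-regime «`e(g) = 1`, point ON a permissible curve that is a coordinate axis in
the current letters». -/
theorem dWinsTo_headDrop_of_apexLine_axis {b : MvPowerSeries (Fin (m + 1)) k} {δ : Decoration k m} (hadm : Admissible b δ)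
    {S : Finset (Fin (m + 1))} (hS : S.Nonempty) {l₀ : Fin (m + 1)} (hl₀ : l₀ ∉ S)
    (hP1g : (δ.c : ℕ∞) ≤ (δ.f * ∏ l ∈ δ.O, X l).weightedOrder (fun j => if j ∈ S then 1 else 0))
    (hone : ∀ u₁ u₂ : Fin (m + 1) → k,
      (∀ v, CobordantChart.initEval (fun _ : Fin (m + 1) => 1) (v + u₁) δ.c (δ.f * ∏ l ∈ δ.O, X l) =
        CobordantChart.initEval (fun _ : Fin (m + 1) => 1) v δ.c (δ.f * ∏ l ∈ δ.O, X l)) →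
      (∀ v, CobordantChart.initEval (fun _ : Fin (m + 1) => 1) (v + u₂) δ.c (δ.f * ∏ l ∈ δ.O, X l) =
        CobordantChart.initEval (fun _ : Fin (m + 1) => 1) v δ.c (δ.f * ∏ l ∈ δ.O, X l)) →
      ∃ α β : k, (α ≠ 0 ∨ β ≠ 0) ∧ α • u₁ + β • u₂ = 0) :
    DWinsTo (St := MvPowerSeries (Fin (m + 1)) k × Decoration k m) Prod.fst
      (fun τ => Admissible τ.1 τ.2 ∧ τ.2.head < δ.head) (b, δ) := by
  have hperm := isBPermissible_X_indicator_of_totalO hadm hS hP1g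
  refine dWinsTo_headDrop_of_orderDrop hadm hperm fun c hc hc0 A G hfac hG i hci => ?_
  have hf : δ.f ≠ 0 := hadm.2.1.ne_zero
  obtain ⟨hA, -⟩ := Decoration.order_slice_totalO_eq hperm hc hf hci hfac hG
  subst hA
  rw [show subst (fun j => (X j : MvPowerSeries (Fin (m + 1)) k)) (δ.f * ∏ l ∈ δ.O, X l) = δ.f * ∏ l ∈ δ.O, X l from
    congrFun subst_self _] at hfac
  exact TOT2Near.order_slice_lt_of_apexLine_curve (fun j => if j ∈ S then 1 else 0) c
    (fun l => by split_ifs <;> simp) hc i hci _ hP1g hone (l := l₀) (if_neg hl₀) hfac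

end TameFourTupleDrop

end Summit.ResolutionOfSingularities.ResolutionOfSingularities.Theorems

end
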